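import Summits.QuantumFields.YangMills.Theorems.UnitScaleTiltHistoryTailIntHistories
import Summits.QuantumFields.YangMills.Theorems.UnitScaleTiltHistoryTailCoreRunRows
import HarnessLib

/-!
# `UnitScaleTiltHistoryTailIntPint` — crux `HistoryTailL` (stmt-QuantumFields-19936), R-57χ successor line: STUB 2″ clauses (c) `PintSize` (`CP := C46·M₁³`) and (d) the
# `Zterm` size (`κZ := Alf`) AT THE INTERIOR DATUM of a family of data cores — the T³ reading `PkgCoreV3.abs_Pint_succ_le` of (46) one step up for a core
# run (`…CoreRunRows`), `dataIntV3_pintSize`; `dataIntV3_Zterm_eq`/`dataIntV3_ztermSize`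
# (`AlphaInputsT3ACv3Pint` §1–§2 and `AlphaInputsT3ACv3Rows` §1, ★alpha-1 g3, with `RunAlphaV3AC ↦ RunAlphaV3CoreAC`, `h.pkgAtV3 hc γ hγ hγ1 K ↦ q K`) — seat ym3-torus-p2 (g16)

Nothing of [Balaban1985UV3] is asserted; CONDITIONAL only on the core run / the family `q` (data carrying its rows).

References: T. Bałaban, Commun. Math. Phys. 102 (1985) 255–275 [Balaban1985UV3] ((33)–(34) p.264, (41) p.266, (44)–(46) p.267, (61) p.271).
-/

set_option autoImplicit false

noncomputable section

namespace Summit.QuantumFields.YangMills.Theorems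

open MeasureTheory
open scoped BigOperators
open Literature.MathematicalPhysics.QuantumFieldTheory.Balaban1983to89
open Literature.MathematicalPhysics.QuantumFieldTheory.Balaban1983to89.T3ContinuumYM3Torus
open Literature.MathematicalPhysics.QuantumFieldTheory.Balaban1983to89.T3UnitScaleTilt (θBal)
open Literature.MathematicalPhysics.QuantumFieldTheory.Balaban1983to89.T3AlphaInputsAC
open Literature.MathematicalPhysics.QuantumFieldTheory.Balaban1983to89.B10Eq38TorusDomains (toFine)
open Literature.MathematicalPhysics.QuantumFieldTheory.Balaban1985CMP102
open Literature.MathematicalPhysics.QuantumFieldTheory.Balaban1985CMP102.Setting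
open Summit.QuantumFields.Balaban3D.Carriers
open Summit.QuantumFields.Balaban3D.Proofs.Primitives
open Summit.QuantumFields.Balaban3D.Proofs.ScalesArithmetic (gk_pos gk_le_one card_site_eq)
open Summit.QuantumFields.Balaban3D.Proofs.UVStability3DInputs (adjAct)
open Summit.QuantumFields.Balaban3D.Proofs.GroupModelLieC (lieC)
open Summit.QuantumFields.Balaban3D.Proofs.FamilyLE (thresholds_of_le)
open Summit.QuantumFields.Balaban3D.Proofs.TowerAC
open Summit.QuantumFields.Balaban3D.Proofs.StandardAC
open Summit.QuantumFields.Balaban3D.Proofs.InputsAC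
open Summit.QuantumFields.Balaban3D.Proofs.AlphaAC (AlphaDataAC)
open Summit.QuantumFields.Balaban3D.Proofs.Bound46AC (abs_pint_le_stdAC)



/-! ## §2 At the T³ data core: `PintSize` for the interior datum -/

section T3

variable {F : T3Family} {𝔠 : AlphaConsts F.L (suGroupModel 2).N} {γ : ℝ} {hγ : 0 < γ} {hγ1 : γ ≤ (min 𝔠.gamma0 1) ^ 2} {K : ℕ}

/-- **(46) FOR THE CORE'S TOWER, ONE STEP UP**: `|Pint_{k+1}(h, W)| ≤ (C46·M₁³)·θBal(K − k)²·#Ω_{k+1}^{(k+1)}(h)` for `k < K` (`g_kp(g_k) = θBal(K − k)`, `PkgCoreV3.eps1_eq`).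
[cite: Balaban1985UV3, (46) p.267] -/
theorem AlphaInputsT3AC.PkgCoreV3.abs_Pint_succ_le (p : AlphaInputsT3AC.PkgCoreV3 F 𝔠 γ hγ hγ1 K) (k : ℕ) (hk : k + 1 ≤ K) (h : Hist (F.P K) (k + 1))
    (W : GaugeField (F.P K) (k + 1) (Matrix.specialUnitaryGroup (Fin 2) ℂ)) :
    |p.T.Pint (k + 1) h W| ≤ (𝔠.C46 * (𝔠.M₁ : ℝ) ^ 3) * θBal F.L γ 𝔠.b₀ 𝔠.p₀ (K - k) ^ 2 *
      (LamFin 𝔠.lane.carrier.M₁ (rcolOf (T3Scales F γ hγ (hγ1.trans (sq_min_one_le _ 𝔠.gamma0_pos)) K) 𝔠.lane.carrier) k h).card := by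
  have h46 := AlphaV3AC.abs_Pint_succ_le_of_alphaV3Core (T3Scales_window F 𝔠 γ hγ hγ1 K) p.runCore k hk h W
  have hε : (T3Scales F γ hγ (hγ1.trans (sq_min_one_le _ 𝔠.gamma0_pos)) K).gk k *
      B10.pFun 𝔠.b₀ 𝔠.p₀ ((T3Scales F γ hγ (hγ1.trans (sq_min_one_le _ 𝔠.gamma0_pos)) K).gk k) = θBal F.L γ 𝔠.b₀ 𝔠.p₀ (K - k) := by
    rw [T3Scales_gk_eq F γ hγ _ K k (by omega)]
    rfl
  rw [hε] at h46
  exact h46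

variable (q : ∀ K, AlphaInputsT3AC.PkgCoreV3 F 𝔠 γ hγ hγ1 K) (π : AlphaInputsT3AC.PolymerT3 F)

/-- **STUB 2″ CLAUSE (c) AT THE INTERIOR DATUM — `PintSize` PROVED, with `CP := C46·M₁³`**: for every run `K`, level `1 ≤ j ≤ K`, history `h` and field `W`,
`|Pint^{(K)}_j(h, W)| ≤ CP·θBal(K − j + 1)²·(sitesPerDir j)³` — (46) p.267 for the package's AC tower (`PkgCoreV3.abs_Pint_succ_le`) with the volume `|Λ_j| ≤ |T^{(j)}|`; the
schema's `Adm` guard is not used. [cite: Balaban1985UV3, (46) p.267] -/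
theorem AlphaInputsT3AC.dataIntV3_pintSize : PintSize (AlphaInputsT3AC.dataIntV3 q π) 𝔠.b₀ 𝔠.p₀ (𝔠.C46 * (𝔠.M₁ : ℝ) ^ 3) := by
  intro K j r W hj hj1 _
  obtain ⟨k, rfl⟩ : ∃ k, j = k + 1 := ⟨j - 1, by omega⟩
  have h46 := (q K).abs_Pint_succ_le k hj r W
  have hvol := card_lamFin_le_sitesPerDir_cube (F := F) (K := K) 𝔠.lane.carrier.M₁
    (rcolOf (T3Scales F γ hγ (hγ1.trans (sq_min_one_le _ 𝔠.gamma0_pos)) K) 𝔠.lane.carrier) k r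
  have hC : 0 ≤ 𝔠.C46 * (𝔠.M₁ : ℝ) ^ 3 * θBal F.L γ 𝔠.b₀ 𝔠.p₀ (K - k) ^ 2 :=
    mul_nonneg (mul_nonneg 𝔠.C46_nonneg (pow_nonneg (Nat.cast_nonneg _) _)) (sq_nonneg _)
  have hKk : K - (k + 1) + 1 = K - k := by omega
  show |(q K).T.Pint (k + 1) r W| ≤ _
  rw [hKk]
  exact h46.trans (mul_le_mul_of_nonneg_left hvol hC)

end T3

/-! ## §3 STUB 2″ clause (d): the size of the large-field term at the interior datum -/

section Zterm

variable {F : T3Family} {𝔠 : AlphaConsts F.L (suGroupModel 2).N} {γ : ℝ} {hγ : 0 < γ} {hγ1 : γ ≤ (min 𝔠.gamma0 1) ^ 2}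
  (q : ∀ K, AlphaInputsT3AC.PkgCoreV3 F 𝔠 γ hγ hγ1 K) (π : AlphaInputsT3AC.PolymerT3 F)

/-- The interior datum's large-field term unfolded: `Zterm^{(K)}_j(h) = Σ_{i<j} zcoefOf i · |Z_i(h)|` (definitional). [cite: Balaban1985UV3, (41) p.266] -/
theorem AlphaInputsT3AC.dataIntV3_Zterm_eq (K j : ℕ) (r : Hist (F.P K) j) :
    (AlphaInputsT3AC.dataIntV3 q π).Zterm K j r =
      ∑ i ∈ Finset.range j, zcoefOf (T3Scales F γ hγ (hγ1.trans (sq_min_one_le _ 𝔠.gamma0_pos)) K) 𝔠.lane.carrier i *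
        (ZVol 𝔠.lane.carrier.M₁ (rcolOf (T3Scales F γ hγ (hγ1.trans (sq_min_one_le _ 𝔠.gamma0_pos)) K) 𝔠.lane.carrier) j r i : ℝ) := rfl

/-- **STUB 2″ CLAUSE (d) AT THE INTERIOR DATUM — THE SIZE OF THE LARGE-FIELD TERM, PROVED with `κZ := 𝔠.Alf`**: for every run `K`, level `j ≤ K`, region history `r` and
fibre variable `v`, `0 ≤ Zterm_j(h) ≤ A·Σ_{i<j} (1 + log(√(γL^{−(K−i)}))⁻¹)·#{y ∈ T^{(i)} : toFine y ∉ Ω_{i+1}(h)}` with `h = assemble r v = r`,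
`A = (C_z + C_v) + C₅ + C₆ + 3(|log σ₀| + d(𝔤))` — «Σ_{j<k} O(log g_j⁻¹)|Z_j|» of (41) p.266. [cite: Balaban1985UV3, (41) p.266] -/
theorem AlphaInputsT3AC.dataIntV3_ztermSize (K j : ℕ) (r : (AlphaInputsT3AC.lfDataIntV3 q π).Reg K j)
    (v : (i : Fin j) → GaugeField (F.P K) i (Matrix.specialUnitaryGroup (Fin 2) ℂ)) (hj : j ≤ K) :
    0 ≤ (AlphaInputsT3AC.dataIntV3 q π).Zterm K j ((AlphaInputsT3AC.lfDataIntV3 q π).assemble K j r v) ∧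
    (AlphaInputsT3AC.dataIntV3 q π).Zterm K j ((AlphaInputsT3AC.lfDataIntV3 q π).assemble K j r v) ≤
      𝔠.Alf * ∑ i ∈ Finset.range j,
        (1 + Real.log (Real.sqrt (γ * ((F.L : ℝ)⁻¹) ^ (K - i)))⁻¹) *
          (({y : Site (F.P K) i | toFine i y ∉ (AlphaInputsT3AC.dataIntV3 q π).Ω K j
              ((AlphaInputsT3AC.lfDataIntV3 q π).assemble K j r v) (i + 1)} : Set (Site (F.P K) i)).ncard : ℝ) := by
  have hγ1' : γ ≤ 1 := hγ1.trans (sq_min_one_le _ 𝔠.gamma0_pos)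
  rw [AlphaInputsT3AC.lfDataIntV3_assemble_eq q π, AlphaInputsT3AC.dataIntV3_Zterm_eq q π, Finset.mul_sum]
  refine ⟨Finset.sum_nonneg fun i hi => ?_, Finset.sum_le_sum fun i hi => ?_⟩
  · have hiK : i ≤ K := (Finset.mem_range.mp hi).le.trans hj
    exact mul_nonneg (𝔠.zcoefOf_nonneg_le (T3Scales F γ hγ hγ1' K) i hiK).1 (Nat.cast_nonneg _)
  · have hij : i < j := Finset.mem_range.mp hi
    have hiK : i ≤ K := hij.le.trans hj
    have hz := (𝔠.zcoefOf_nonneg_le (T3Scales F γ hγ hγ1' K) i hiK).2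
    rw [T3Scales_gk_eq F γ hγ hγ1' K i hiK] at hz
    have hvol : (ZVol 𝔠.lane.carrier.M₁ (rcolOf (T3Scales F γ hγ hγ1' K) 𝔠.lane.carrier) j r i : ℝ) =
        (({y : Site (F.P K) i | toFine i y ∉ (AlphaInputsT3AC.dataIntV3 q π).Ω K j r (i + 1)} : Set (Site (F.P K) i)).ncard : ℝ) :=
      ZVol_eq_ncard _ _ j r i hij (by show i ≤ F.m + K; omega)
    rw [hvol, ← mul_assoc]
    exact mul_le_mul_of_nonneg_right hz (Nat.cast_nonneg _)

end Zterm

end Summit.QuantumFields.YangMills.Theorems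

end
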